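import Mathlib
import Literature.Analysis.FluidPDE.SuitableWeak
import Literature.Analysis.FluidPDE.SpaceTimeRescaling
import Literature.Analysis.FluidPDE.ClassicalSuitable
import Literature.Analysis.FluidPDE.WeakSpatialGradientSum
import Literature.Analysis.FluidPDE.NSSuitableESSProofs
import Summits.NavierStokesRegularity.NavierStokesRegularity.Theorems.TypeILiouvilleTypeIliouvilleNoTypeIIPowerGaugeSteady
import Summits.NavierStokesRegularity.NavierStokesRegularity.Theorems.EulerZoomLiouvillePowerGaugeEulerLiouvilleTimePeriodicTools
import Summits.NavierStokesRegularity.NavierStokesRegularity.Theorems.EulerZoomLiouvillePowerGaugeEulerLiouvillePastTimePeriodic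
import Summits.NavierStokesRegularity.NavierStokesRegularity.Theorems.EulerZoomLiouvillePowerGaugeEulerLiouvillePastSymmetric
import HarnessLib

/-!
# FRAME-PERIODIC PAST MEMBERS ARE TRIVIAL (line `galilean-frames`, stub F2 `stub_framePeriodic`, by name; crux = stmt-NavierStokesRegularity-19832)

Route `EulerZoomLiouville` (NavierStokesRegularity); width seat ns-ezl-w6 g2 (LEAD ns-typeII-p2 g12; line `galilean-frames` of ns-idea-11 g6, 2026-08-28).
A member `(u, p, H, c)` of Seregin's power-gauged ancient Euler class (`ρ > 0`) whose past is FRAME-PERIODIC — `u(τ, y) = u(τ − P, y − d) + w`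
for all `τ < T₁ ≤ 0` (period `P > 0`, spatial HOP `d`, BOOST `w`) — vanishes a.e. on the slab: `FramePeriodic.ae_eq_zero_of_gauge_of_pastFramePeriodic`,
and BY NAME `FramePeriodic.framePeriodic_stratum : InClass ρ u p H c → IsPastFramePeriodic u → VanishesAE u` (bodies verbatim, every `ρ > 0`).
The hop/boost generalisation of the time-periodic past branch (`PastPeriodic.ae_eq_zero_of_gauge_of_pastTimePeriodic`, `(d, w) = 0`), same toolbox:
(1) the weak gradient is a.e. HOP-PERIODIC on the past, `H(τ − P, y − d) = H(τ, y)` (translate by `(−P, −d)` with `HasWeakSpatialGradientOn.stRescale`,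
the boost is a constant with zero weak gradient, a.e. uniqueness `HasWeakSpatialGradientOn.ae_eq` on finite slabs) — no separate boost kill is needed;
(2) the period boxes with DRIFTING balls `(T₁ − (k+1)P, T₁ − kP) × B_R(−k d)` all carry the mass `J(R)` of `(T₁ − P, T₁) × B_R`
(`setLIntegral_preimage_comp_stAffine`); (3) `m` of them packed in `Q_a(0)`, `a = m(‖d‖ + P + |R| + |T₁| + 1)`: `m J ≤ c a^{1−ρ}`
(`TimePeriodic.setLIntegral_window_le_of_gaugeE`), so `J ≤ c S^{1−ρ} m^{−ρ} → 0`; (4) `H = 0` a.e. on `(−∞, T₁) × ℝ³` (the windows at `T₁` and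
`T₁ − P/2` cover the seams) ⇒ a.e. slice a.e. constant (`PowerGaugeSteady.ae_slice_const_of_weakGradient_ae_zero`) ⇒ zero energy
(`PastPeriodic.lintegral_slice_eq_zero_of_ae_const_of_gaugeA`) ⇒ `PastSymmetric.ae_eq_zero_of_gauge_of_pastSlicesZero`.
WHAT THIS IS NOT: not NS, not E — one more CLOSED-FORM stratum (relative periodic orbits modulo Galilei) of the crux CLASS on the MODEL lattice
(`--supports` stmt-19832); 19832 OPEN. [folklore]
-/

noncomputable section

set_option linter.dupNamespace false -- flat `Theorems/<Route><Decl>…` files share the crux namespace `Summit.<S>.<S>.…`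

open MeasureTheory Set Filter Topology Metric Function TopologicalSpace
open scoped ENNReal NNReal

namespace Summit.NavierStokesRegularity.NavierStokesRegularity.Theorems.PowerGaugeEulerLiouville

open Literature.Analysis Literature.Analysis.FunctionSpaces Literature.Analysis.FluidPDE

namespace FramePeriodic

variable {u : ℝ → EuclideanSpace ℝ (Fin 3) → EuclideanSpace ℝ (Fin 3)}
  {H : ℝ → EuclideanSpace ℝ (Fin 3) → EuclideanSpace ℝ (Fin 3) →L[ℝ] EuclideanSpace ℝ (Fin 3)}
  {T₁ P : ℝ} {d w : EuclideanSpace ℝ (Fin 3)}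

/-! ## (1) The weak gradient of a frame-periodic past is a.e. hop-periodic -/

/-- The translate of a slab by `(t₀, x₀)`: `Φ⁻¹((a, b) × ℝ³) = (a − t₀, b − t₀) × ℝ³` for `Φ(s, y) = (t₀ + s, x₀ + y)`. [folklore] -/
theorem stPreimage_one_slab_Ioo (t₀ a b : ℝ) (x₀ : EuclideanSpace ℝ (Fin 3)) :
    stPreimage 1 1 t₀ x₀ (slab (EuclideanSpace ℝ (Fin 3)) (Ioo a b) isOpen_Ioo) =
      slab (EuclideanSpace ℝ (Fin 3)) (Ioo (a - t₀) (b - t₀)) isOpen_Ioo := by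
  ext ⟨s, y⟩
  simp only [SetLike.mem_coe, mem_stPreimage, stAffine_apply, mem_slab, mem_Ioo, one_mul]
  constructor <;> rintro ⟨h1, h2⟩ <;> constructor <;> linarith

/-- **A.e. hop-periodicity of the weak gradient.**  If `u(τ, ·) = u(τ − P, · − d) + w` for all `τ < T₁ ≤ 0` (`P ≥ 0`) and `H` is a weak spatial
gradient of `u` on the slab `(−∞, 0) × ℝ³`, then `H(τ − P, y − d) = H(τ, y)` for a.e. `(τ, y)` with `τ < T₁` (the translate `H(· − P, · − d)` is a weak
gradient of `u(· − P, · − d) + w = u` on every finite slab `(−M + P, T₁) × ℝ³`, the boost contributing zero; weak gradients are a.e. unique). [folklore] -/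
theorem weakGradient_ae_hopShift
    (hH : HasWeakSpatialGradientOn (slab (EuclideanSpace ℝ (Fin 3)) (Iio 0) isOpen_Iio) u H) (hT₁ : T₁ ≤ 0) (hP : 0 ≤ P)
    (hu : ∀ τ : ℝ, τ < T₁ → u τ = fun y => u (τ - P) (y - d) + w) :
    ∀ᵐ z ∂(volume.restrict (Iio T₁ ×ˢ (univ : Set (EuclideanSpace ℝ (Fin 3))))), H (z.1 - P) (z.2 - d) = H z.1 z.2 := by
  have hM : ∀ M : ℕ, ∀ᵐ z ∂(volume.restrict (Ioo (-(M : ℝ)) T₁ ×ˢ (univ : Set (EuclideanSpace ℝ (Fin 3))))),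
      H (z.1 - P) (z.2 - d) = H z.1 z.2 := by
    intro M
    -- the translate by `(−P, −d)` on the finite slab `(−M − P, 0)`, pulled back to `(−M, P)` and cut to `(−M, T₁)`
    have h1 : HasWeakSpatialGradientOn (slab (EuclideanSpace ℝ (Fin 3)) (Ioo (-(M : ℝ) - P) 0) isOpen_Ioo) u H :=
      hH.mono (slab_mono Ioo_subset_Iio_self)
    have h2 := h1.stRescale 1 one_pos one_pos (-P) (-d)
    rw [stPreimage_one_slab_Ioo, one_smul, one_mul, one_smul] at h2
    have h3 : HasWeakSpatialGradientOn (slab (EuclideanSpace ℝ (Fin 3)) (Ioo (-(M : ℝ)) T₁) isOpen_Ioo)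
        (stPull 1 1 (-P) (-d) u) (stPull 1 1 (-P) (-d) H) :=
      h2.mono (slab_mono (Ioo_subset_Ioo (by linarith) (by linarith)))
    -- the boost: a constant, weak gradient `0`
    have h4 : HasWeakSpatialGradientOn (slab (EuclideanSpace ℝ (Fin 3)) (Ioo (-(M : ℝ)) T₁) isOpen_Ioo)
        (fun (_ : ℝ) (_ : EuclideanSpace ℝ (Fin 3)) => w)
        (fun (_ : ℝ) (y : EuclideanSpace ℝ (Fin 3)) => fderiv ℝ (fun _ : EuclideanSpace ℝ (Fin 3) => w) y) :=
      hasWeakSpatialGradientOn_of_contDiffOn (S := Ioo (-(M : ℝ)) T₁) isOpen_Ioo (by rw [coe_slab])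
        (by exact contDiffOn_const)
    have h5 := h3.add h4
    -- it is a weak gradient of `u` itself on the cut slab
    have h6 : HasWeakSpatialGradientOn (slab (EuclideanSpace ℝ (Fin 3)) (Ioo (-(M : ℝ)) T₁) isOpen_Ioo) u
        (fun t x => stPull 1 1 (-P) (-d) H t x + fderiv ℝ (fun _ : EuclideanSpace ℝ (Fin 3) => w) x) := by
      refine h5.congr_eqOn fun z hz => ?_
      have hz' : z.1 < T₁ := (mem_Ioo.1 (mem_slab.1 hz)).2
      show u z.1 z.2 = stPull 1 1 (-P) (-d) u z.1 z.2 + w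
      rw [hu z.1 hz', stPull_apply, one_mul, one_smul, neg_add_eq_sub, neg_add_eq_sub]
    have h7 : HasWeakSpatialGradientOn (slab (EuclideanSpace ℝ (Fin 3)) (Ioo (-(M : ℝ)) T₁) isOpen_Ioo) u H :=
      hH.mono (slab_mono fun τ hτ => lt_of_lt_of_le hτ.2 hT₁)
    have h8 := h6.ae_eq h7
    rw [coe_slab] at h8
    filter_upwards [h8] with z hz
    have hz' : stPull 1 1 (-P) (-d) H z.1 z.2 + fderiv ℝ (fun _ : EuclideanSpace ℝ (Fin 3) => w) z.2 = H z.1 z.2 := hz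
    have e0 : fderiv ℝ (fun _ : EuclideanSpace ℝ (Fin 3) => w) z.2 = 0 := by simp
    rwa [stPull_apply, one_mul, one_smul, neg_add_eq_sub, neg_add_eq_sub, e0, add_zero] at hz'
  -- exhaust `(−∞, T₁)`
  have hU : (Iio T₁ ×ˢ (univ : Set (EuclideanSpace ℝ (Fin 3)))) =
      ⋃ M : ℕ, (Ioo (-(M : ℝ)) T₁ ×ˢ (univ : Set (EuclideanSpace ℝ (Fin 3)))) := by
    ext z
    simp only [mem_prod, mem_Iio, mem_univ, and_true, mem_iUnion, mem_Ioo]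
    constructor
    · intro hz
      obtain ⟨M, hM⟩ := exists_nat_gt (-z.1)
      exact ⟨M, by linarith, hz⟩
    · rintro ⟨M, -, h2⟩
      exact h2
  rw [hU, ae_restrict_iUnion_iff]
  exact hM

/-! ## (2) Every drifting period box carries the same enstrophy mass -/

/-- **Hop-shifting a box inside the past does not change the enstrophy mass**: for `t₂ ≤ T₁`,
`∫_{(t₁−P, t₂−P) × B_R(x − d)} |H|²_F = ∫_{(t₁, t₂) × B_R(x)} |H|²_F`. [folklore] -/
theorem setLIntegral_box_hopShift
    (hper : ∀ᵐ z ∂(volume.restrict (Iio T₁ ×ˢ (univ : Set (EuclideanSpace ℝ (Fin 3))))), H (z.1 - P) (z.2 - d) = H z.1 z.2)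
    {t₁ t₂ : ℝ} (ht₂ : t₂ ≤ T₁) (x : EuclideanSpace ℝ (Fin 3)) (R : ℝ) :
    ∫⁻ z in Ioo (t₁ - P) (t₂ - P) ×ˢ ball (x - d) R, ENNReal.ofReal (frobeniusNormSq (H z.1 z.2)) =
      ∫⁻ z in Ioo t₁ t₂ ×ˢ ball x R, ENNReal.ofReal (frobeniusNormSq (H z.1 z.2)) := by
  have h := setLIntegral_preimage_comp_stAffine one_pos one_pos (-P) (-d)
    (fun z : ℝ × EuclideanSpace ℝ (Fin 3) => ENNReal.ofReal (frobeniusNormSq (H z.1 z.2)))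
    (Ioo (t₁ - P) (t₂ - P) ×ˢ ball (x - d) R)
  have hpre : stAffine 1 1 (-P) (-d) ⁻¹' (Ioo (t₁ - P) (t₂ - P) ×ˢ ball (x - d) R) =
      Ioo t₁ t₂ ×ˢ ball (x : EuclideanSpace ℝ (Fin 3)) R := by
    ext ⟨s, y⟩
    simp only [mem_preimage, stAffine_apply, one_mul, one_smul, mem_prod, mem_Ioo, mem_ball, dist_eq_norm]
    rw [show -d + y - (x - d) = y - x by abel]
    constructor <;> rintro ⟨⟨h1, h2⟩, h3⟩ <;> exact ⟨⟨by linarith, by linarith⟩, h3⟩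
  rw [hpre, finrank_euclideanSpace_fin, one_pow, mul_one, inv_one, ENNReal.ofReal_one, one_mul] at h
  rw [← h]
  refine setLIntegral_congr_fun_ae (measurableSet_Ioo.prod measurableSet_ball) ?_
  have hsub : Ioo t₁ t₂ ×ˢ ball x R ⊆ Iio T₁ ×ˢ (univ : Set (EuclideanSpace ℝ (Fin 3))) :=
    Set.prod_mono (fun τ hτ => lt_of_lt_of_le hτ.2 ht₂) (subset_univ _)
  filter_upwards [ae_imp_of_ae_restrict (ae_restrict_of_ae_restrict_of_subset hsub hper)] with z hz hzmem
  show ENNReal.ofReal (frobeniusNormSq (H (-P + 1 * z.1) (-d + (1 : ℝ) • z.2))) = ENNReal.ofReal (frobeniusNormSq (H z.1 z.2))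
  rw [one_mul, one_smul, neg_add_eq_sub, neg_add_eq_sub, hz hzmem]

/-- **Every drifting period box carries the same mass**: `∫_{(T₁−(k+1)P, T₁−kP) × B_R(−k d)} |H|²_F = ∫_{(T₁−P, T₁) × B_R(0)} |H|²_F` (`P ≥ 0`). [folklore] -/
theorem setLIntegral_periodBox_eq (hP : 0 ≤ P)
    (hper : ∀ᵐ z ∂(volume.restrict (Iio T₁ ×ˢ (univ : Set (EuclideanSpace ℝ (Fin 3))))), H (z.1 - P) (z.2 - d) = H z.1 z.2)
    (R : ℝ) (k : ℕ) :
    ∫⁻ z in Ioo (T₁ - ((k : ℝ) + 1) * P) (T₁ - (k : ℝ) * P) ×ˢ ball (-((k : ℝ) • d)) R, ENNReal.ofReal (frobeniusNormSq (H z.1 z.2)) =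
      ∫⁻ z in Ioo (T₁ - P) T₁ ×ˢ ball (0 : EuclideanSpace ℝ (Fin 3)) R, ENNReal.ofReal (frobeniusNormSq (H z.1 z.2)) := by
  induction k with
  | zero => simp
  | succ k ih =>
    have ht₂ : T₁ - (k : ℝ) * P ≤ T₁ := by
      have : 0 ≤ (k : ℝ) * P := by positivity
      linarith
    have h := setLIntegral_box_hopShift hper (t₁ := T₁ - ((k : ℝ) + 1) * P) ht₂ (-((k : ℝ) • d)) R
    have e1 : T₁ - ((k : ℝ) + 1) * P - P = T₁ - (((k + 1 : ℕ) : ℝ) + 1) * P := by push_cast; ring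
    have e2 : T₁ - (k : ℝ) * P - P = T₁ - ((k + 1 : ℕ) : ℝ) * P := by push_cast; ring
    have e3 : -((k : ℝ) • d) - d = -(((k + 1 : ℕ) : ℝ) • d) := by rw [Nat.cast_succ, add_smul, one_smul, neg_add']
    rw [e1, e2, e3] at h
    rw [← ih, ← h]

/-! ## (3) Packing `m` drifting boxes into `Q_a(0)` and the vanishing of the period mass -/

/-- **The period mass vanishes.**  If `H` is a.e. hop-periodic below `T₁ ≤ 0` (`P > 0`) and `a^ρ E(H; Q_a(0)) ≤ c` for all `a > 0` with `ρ > 0`, then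
`∫_{(T₁−P, T₁) × B_R} |H|²_F = 0` for every `R`: `m` disjoint drifting boxes sit in `Q_a(0)` for `a = m S`, `S = ‖d‖ + P + |R| + |T₁| + 1`, so
`m J ≤ c (m S)^{1−ρ}`, `J ≤ c S^{1−ρ} m^{−ρ} → 0`. [folklore] -/
theorem setLIntegral_periodBox_eq_zero (hT₁ : T₁ ≤ 0) (hP : 0 < P)
    (hper : ∀ᵐ z ∂(volume.restrict (Iio T₁ ×ˢ (univ : Set (EuclideanSpace ℝ (Fin 3))))), H (z.1 - P) (z.2 - d) = H z.1 z.2)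
    {ρ : ℝ} (hρ : 0 < ρ) {c : ℝ≥0}
    (hE : ∀ a : ℝ, 0 < a → ENNReal.ofReal (a ^ ρ) * cknE a (0 : ℝ × EuclideanSpace ℝ (Fin 3)) H ≤ (c : ℝ≥0∞)) (R : ℝ) :
    ∫⁻ z in Ioo (T₁ - P) T₁ ×ˢ ball (0 : EuclideanSpace ℝ (Fin 3)) R, ENNReal.ofReal (frobeniusNormSq (H z.1 z.2)) = 0 := by
  set f : ℝ × EuclideanSpace ℝ (Fin 3) → ℝ≥0∞ := fun z => ENNReal.ofReal (frobeniusNormSq (H z.1 z.2)) with hf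
  set J : ℝ≥0∞ := ∫⁻ z in Ioo (T₁ - P) T₁ ×ˢ ball (0 : EuclideanSpace ℝ (Fin 3)) R, f z with hJ
  set S : ℝ := ‖d‖ + P + |R| + |T₁| + 1 with hS
  have hS1 : 1 ≤ S := by rw [hS]; linarith [norm_nonneg d, abs_nonneg R, abs_nonneg T₁, hP.le]
  have hS0 : 0 < S := by linarith
  -- the drifting boxes
  set box : ℕ → Set (ℝ × EuclideanSpace ℝ (Fin 3)) :=
    fun k => Ioo (T₁ - ((k : ℝ) + 1) * P) (T₁ - (k : ℝ) * P) ×ˢ ball (-((k : ℝ) • d)) R with hbox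
  have hboxm : ∀ k, MeasurableSet (box k) := fun k => measurableSet_Ioo.prod measurableSet_ball
  have hdisj : Pairwise (Disjoint on box) := by
    intro i j hij
    rcases lt_or_gt_of_ne hij with h | h
    · refine Disjoint.set_prod_left (disjoint_left.2 fun τ h1 h2 => ?_) _ _
      have : ((i : ℝ) + 1) * P ≤ (j : ℝ) * P := mul_le_mul_of_nonneg_right (by exact_mod_cast h) hP.le
      linarith [h1.1, h2.2]
    · refine Disjoint.set_prod_left (disjoint_left.2 fun τ h1 h2 => ?_) _ _
      have : ((j : ℝ) + 1) * P ≤ (i : ℝ) * P := mul_le_mul_of_nonneg_right (by exact_mod_cast h) hP.le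
      linarith [h1.2, h2.1]
  -- `J ≤ c S^{1−ρ} m^{−ρ}` for every `m ≥ 1`
  have key : ∀ m : ℕ, 1 ≤ m → J ≤ ENNReal.ofReal ((c : ℝ) * S ^ (1 - ρ) * (m : ℝ) ^ (-ρ)) := by
    intro m hm
    have hm1 : (1 : ℝ) ≤ m := by exact_mod_cast hm
    set a : ℝ := (m : ℝ) * S with ha
    have ha1 : 1 ≤ a := by rw [ha]; nlinarith
    have ha0 : 0 < a := by linarith
    -- the boxes `k < m` are disjoint subsets of the window `(−a², 0) × B_a`
    have hsub : (⋃ k ∈ Finset.range m, box k) ⊆ Ioo (-(a ^ 2)) 0 ×ˢ ball (0 : EuclideanSpace ℝ (Fin 3)) a := by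
      intro z hz
      simp only [mem_iUnion, Finset.mem_range, exists_prop] at hz
      obtain ⟨k, hk, hz⟩ := hz
      have hk' : (k : ℝ) + 1 ≤ m := by exact_mod_cast hk
      have hk0 : (0 : ℝ) ≤ k := k.cast_nonneg
      rw [hbox, mem_prod, mem_Ioo, mem_ball, dist_eq_norm] at hz
      refine mem_prod.2 ⟨⟨?_, ?_⟩, ?_⟩
      · -- `−a² < T₁ − (k+1)P`
        have h1 : ((k : ℝ) + 1) * P ≤ (m : ℝ) * P := mul_le_mul_of_nonneg_right hk' hP.le
        have h2 : (m : ℝ) * P + |T₁| + 1 ≤ a := by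
          rw [ha, hS]; nlinarith [norm_nonneg d, abs_nonneg R, abs_nonneg T₁]
        have h3 : a ≤ a ^ 2 := by nlinarith
        linarith [hz.1.1, neg_abs_le T₁]
      · linarith [hz.1.2, mul_nonneg hk0 hP.le]
      · rw [mem_ball, dist_eq_norm, sub_zero]
        have h1 : ‖z.2‖ ≤ ‖z.2 - -((k : ℝ) • d)‖ + ‖(k : ℝ) • d‖ := by
          have := norm_add_le (z.2 - -((k : ℝ) • d)) (-((k : ℝ) • d))
          rwa [sub_add_cancel, norm_neg] at this
        have h2 : ‖(k : ℝ) • d‖ ≤ (m : ℝ) * ‖d‖ := by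
          rw [norm_smul, Real.norm_eq_abs, abs_of_nonneg hk0]
          exact mul_le_mul_of_nonneg_right (by linarith) (norm_nonneg d)
        have h3 : (m : ℝ) * ‖d‖ + R < a := by
          have h4 : (1 : ℝ) * (P + |R| + |T₁| + 1) ≤ (m : ℝ) * (P + |R| + |T₁| + 1) :=
            mul_le_mul_of_nonneg_right hm1 (by positivity)
          rw [ha, hS]; linarith [le_abs_self R, abs_nonneg T₁]
        linarith [hz.2]
    have h1 : (m : ℝ≥0∞) * J = ∫⁻ z in ⋃ k ∈ Finset.range m, box k, f z := by
      rw [lintegral_biUnion_finset (fun i _ j _ hij => hdisj hij) (fun k _ => hboxm k),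
        Finset.sum_congr rfl fun k _ => setLIntegral_periodBox_eq hP.le hper R k, Finset.sum_const, Finset.card_range,
        nsmul_eq_mul]
    have h2 := TimePeriodic.setLIntegral_window_le_of_gaugeE (H := H) (T := a ^ 2) ha0 le_rfl le_rfl (hE a ha0)
    have h3 : (m : ℝ≥0∞) * J ≤ ENNReal.ofReal ((c : ℝ) * a ^ (1 - ρ)) := by
      rw [h1]; exact (lintegral_mono_set hsub).trans h2
    -- divide by `m`
    have hm0 : (0 : ℝ) < m := by linarith
    have hm0' : (m : ℝ≥0∞) ≠ 0 := by exact_mod_cast (show (m : ℕ) ≠ 0 by exact_mod_cast hm0.ne')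
    have h4 : J ≤ ENNReal.ofReal ((c : ℝ) * a ^ (1 - ρ)) / (m : ℝ≥0∞) := by
      rw [ENNReal.le_div_iff_mul_le (Or.inl hm0') (Or.inl (ENNReal.natCast_ne_top m)), mul_comm]
      exact h3
    refine h4.trans (le_of_eq ?_)
    rw [← ENNReal.ofReal_natCast, ← ENNReal.ofReal_div_of_pos hm0]
    congr 1
    rw [ha, Real.mul_rpow hm0.le hS0.le, Real.rpow_sub hm0, Real.rpow_one, Real.rpow_neg hm0.le]
    field_simp
  -- the right-hand side tends to `0`
  have hlim : Tendsto (fun m : ℕ => ENNReal.ofReal ((c : ℝ) * S ^ (1 - ρ) * (m : ℝ) ^ (-ρ))) atTop (𝓝 0) := by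
    have h1 : Tendsto (fun m : ℕ => ((m : ℝ)) ^ (-ρ)) atTop (𝓝 0) :=
      (tendsto_rpow_neg_atTop hρ).comp tendsto_natCast_atTop_atTop
    have h2 := h1.const_mul ((c : ℝ) * S ^ (1 - ρ))
    rw [mul_zero] at h2
    have h3 := ENNReal.tendsto_ofReal h2
    rwa [ENNReal.ofReal_zero] at h3
  have key' : ∀ᶠ m : ℕ in atTop, J ≤ ENNReal.ofReal ((c : ℝ) * S ^ (1 - ρ) * (m : ℝ) ^ (-ρ)) :=
    (eventually_ge_atTop 1).mono key
  exact le_antisymm (le_of_tendsto_of_tendsto tendsto_const_nhds hlim key') bot_le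

/-! ## (4) The weak gradient vanishes a.e. below `T₁` -/

/-- **`H = 0` a.e. on every drifting period box** `(T₁ − (k+1)P, T₁ − kP) × ℝ³`. [folklore] -/
theorem weakGradient_ae_zero_periodBox (hT₁ : T₁ ≤ 0) (hP : 0 < P)
    (hper : ∀ᵐ z ∂(volume.restrict (Iio T₁ ×ˢ (univ : Set (EuclideanSpace ℝ (Fin 3))))), H (z.1 - P) (z.2 - d) = H z.1 z.2)
    (hHm : AEStronglyMeasurable (uncurry H) (volume.restrict (Iio (0 : ℝ) ×ˢ (univ : Set (EuclideanSpace ℝ (Fin 3))))))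
    {ρ : ℝ} (hρ : 0 < ρ) {c : ℝ≥0}
    (hE : ∀ a : ℝ, 0 < a → ENNReal.ofReal (a ^ ρ) * cknE a (0 : ℝ × EuclideanSpace ℝ (Fin 3)) H ≤ (c : ℝ≥0∞)) (k : ℕ) :
    ∀ᵐ z ∂(volume.restrict (Ioo (T₁ - ((k : ℝ) + 1) * P) (T₁ - (k : ℝ) * P) ×ˢ (univ : Set (EuclideanSpace ℝ (Fin 3))))),
      H z.1 z.2 = 0 := by
  set f : ℝ × EuclideanSpace ℝ (Fin 3) → ℝ≥0∞ := fun z => ENNReal.ofReal (frobeniusNormSq (H z.1 z.2)) with hf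
  have hk0 : (0 : ℝ) ≤ (k : ℝ) * P := by positivity
  have hIsub : Ioo (T₁ - ((k : ℝ) + 1) * P) (T₁ - (k : ℝ) * P) ⊆ Iio (0 : ℝ) := fun τ hτ => by
    have := hτ.2; exact lt_of_lt_of_le (by linarith) hT₁
  have hfm : AEMeasurable f (volume.restrict
      (Ioo (T₁ - ((k : ℝ) + 1) * P) (T₁ - (k : ℝ) * P) ×ˢ (univ : Set (EuclideanSpace ℝ (Fin 3))))) :=
    ((ENNReal.continuous_ofReal.comp LerayHopfProofs.continuous_frobeniusNormSq).comp_aestronglyMeasurable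
      (hHm.mono_set (Set.prod_mono hIsub Subset.rfl))).aemeasurable
  -- on each ball `B_n(−k d)` the mass is the period mass, `0`
  have hball : ∀ n : ℕ, ∀ᵐ z ∂(volume.restrict
      (Ioo (T₁ - ((k : ℝ) + 1) * P) (T₁ - (k : ℝ) * P) ×ˢ ball (-((k : ℝ) • d)) (n : ℝ))), f z = 0 := by
    intro n
    have h0 : ∫⁻ z in Ioo (T₁ - ((k : ℝ) + 1) * P) (T₁ - (k : ℝ) * P) ×ˢ ball (-((k : ℝ) • d)) (n : ℝ), f z = 0 := by
      rw [hf, setLIntegral_periodBox_eq hP.le hper (n : ℝ) k]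
      exact setLIntegral_periodBox_eq_zero hT₁ hP hper hρ hE n
    exact (lintegral_eq_zero_iff' (hfm.mono_set (Set.prod_mono Subset.rfl (subset_univ _)))).1 h0
  have hU : (Ioo (T₁ - ((k : ℝ) + 1) * P) (T₁ - (k : ℝ) * P) ×ˢ (univ : Set (EuclideanSpace ℝ (Fin 3)))) =
      ⋃ n : ℕ, (Ioo (T₁ - ((k : ℝ) + 1) * P) (T₁ - (k : ℝ) * P) ×ˢ ball (-((k : ℝ) • d)) (n : ℝ)) := by
    rw [← prod_iUnion]
    congr 1
    ext y
    simp only [mem_univ, mem_iUnion, mem_ball, true_iff]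
    obtain ⟨n, hn⟩ := exists_nat_gt (dist y (-((k : ℝ) • d)))
    exact ⟨n, hn⟩
  rw [hU, ae_restrict_iUnion_iff]
  intro n
  filter_upwards [hball n] with z hz
  have h1 : frobeniusNormSq (H z.1 z.2) ≤ 0 := ENNReal.ofReal_eq_zero.1 hz
  have h2 : ‖H z.1 z.2‖ ^ 2 ≤ 0 := (sq_opNorm_le_frobeniusNormSq _).trans h1
  exact norm_eq_zero.1 (by nlinarith [norm_nonneg (H z.1 z.2)])

/-- **The weak gradient of a frame-periodic past member vanishes a.e. below `T₁`** (`ρ > 0`): the drifting period boxes at `T₁` and at `T₁ − P/2`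
cover `(−∞, T₁) × ℝ³`. [folklore] -/
theorem weakGradient_ae_zero_past
    (hH : HasWeakSpatialGradientOn (slab (EuclideanSpace ℝ (Fin 3)) (Iio 0) isOpen_Iio) u H) (hT₁ : T₁ ≤ 0) (hP : 0 < P)
    (hu : ∀ τ : ℝ, τ < T₁ → u τ = fun y => u (τ - P) (y - d) + w)
    {ρ : ℝ} (hρ : 0 < ρ) {c : ℝ≥0}
    (hE : ∀ a : ℝ, 0 < a → ENNReal.ofReal (a ^ ρ) * cknE a (0 : ℝ × EuclideanSpace ℝ (Fin 3)) H ≤ (c : ℝ≥0∞)) :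
    ∀ᵐ z ∂(volume.restrict (Iio T₁ ×ˢ (univ : Set (EuclideanSpace ℝ (Fin 3))))), H z.1 z.2 = 0 := by
  have hHm : AEStronglyMeasurable (uncurry H) (volume.restrict (Iio (0 : ℝ) ×ˢ (univ : Set (EuclideanSpace ℝ (Fin 3))))) := by
    have := hH.locallyIntegrableOn_grad.aestronglyMeasurable
    simpa [slab] using this
  -- two families of windows: at `T₁` and at `T₁ − P/2`
  have hT₁' : T₁ - P / 2 ≤ 0 := by linarith
  have hu' : ∀ τ : ℝ, τ < T₁ - P / 2 → u τ = fun y => u (τ - P) (y - d) + w := fun τ hτ => hu τ (by linarith)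
  have hA := fun k => weakGradient_ae_zero_periodBox hT₁ hP (weakGradient_ae_hopShift hH hT₁ hP.le hu) hHm hρ hE k
  have hB := fun k => weakGradient_ae_zero_periodBox hT₁' hP (weakGradient_ae_hopShift hH hT₁' hP.le hu') hHm hρ hE k
  have hcover : Iio T₁ ×ˢ (univ : Set (EuclideanSpace ℝ (Fin 3))) ⊆
      (⋃ k : ℕ, Ioo (T₁ - ((k : ℝ) + 1) * P) (T₁ - (k : ℝ) * P) ×ˢ (univ : Set (EuclideanSpace ℝ (Fin 3)))) ∪
        ⋃ k : ℕ, Ioo (T₁ - P / 2 - ((k : ℝ) + 1) * P) (T₁ - P / 2 - (k : ℝ) * P) ×ˢ (univ : Set (EuclideanSpace ℝ (Fin 3))) := by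
    intro z hz
    have hz1 : z.1 < T₁ := (mem_prod.1 hz).1
    -- `k = ⌊(T₁ − z.1)/P⌋₊`; if `z.1` is a seam `T₁ − kP` use the shifted family
    simp only [mem_union, mem_iUnion, mem_prod, mem_Ioo, mem_univ, and_true]
    obtain ⟨k, hk⟩ := exists_nat_gt ((T₁ - z.1) / P)
    -- the least `k` with `z.1 > T₁ − (k+1)P`
    classical
    have hex : ∃ k : ℕ, T₁ - ((k : ℝ) + 1) * P < z.1 := ⟨k, by
      have := (div_lt_iff₀ hP).1 hk; linarith⟩
    set k₀ := Nat.find hex with hk₀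
    have hk₀s : T₁ - ((k₀ : ℝ) + 1) * P < z.1 := Nat.find_spec hex
    have hk₀m : ∀ j : ℕ, j < k₀ → ¬ T₁ - ((j : ℝ) + 1) * P < z.1 := fun j hj => Nat.find_min hex hj
    by_cases hup : z.1 < T₁ - (k₀ : ℝ) * P
    · exact Or.inl ⟨k₀, hk₀s, hup⟩
    · -- `z.1 ≥ T₁ − k₀P`; by minimality `z.1 ≤ T₁ − k₀ P`, so `z.1 = T₁ − k₀P` with `k₀ ≥ 1`: use the shifted window
      have hge : T₁ - (k₀ : ℝ) * P ≤ z.1 := not_lt.1 hup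
      have hk₀pos : 0 < k₀ := by
        by_contra h0
        have : k₀ = 0 := by omega
        rw [this, Nat.cast_zero, zero_mul, sub_zero] at hge
        linarith
      have hle : z.1 ≤ T₁ - (k₀ : ℝ) * P := by
        have := hk₀m (k₀ - 1) (by omega)
        rw [not_lt, Nat.cast_sub (by omega), Nat.cast_one, sub_add_cancel] at this
        exact this
      refine Or.inr ⟨k₀ - 1, ?_, ?_⟩
      · rw [Nat.cast_sub (by omega), Nat.cast_one, sub_add_cancel]; linarith
      · rw [Nat.cast_sub (by omega), Nat.cast_one]; linarith
  refine ae_restrict_of_ae_restrict_of_subset hcover ?_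
  rw [ae_restrict_union_iff, ae_restrict_iUnion_iff, ae_restrict_iUnion_iff]
  exact ⟨hA, hB⟩

/-! ## (5) The stratum -/

/-- **Members of the power-gauged class with a FRAME-PERIODIC PAST are trivial** (`ρ > 0`).  Let `(u, p)` be a suitable weak Euler pair on
`(−∞,0) × ℝ³` with weak spatial gradient `H` in Seregin's class `a^{2ρ}A(a) + a^{ρ}E(a) + a^{2ρ}D(a) ≤ c` (all `a > 0`), and suppose that on a past
sub-slab `τ < T₁ ≤ 0` it is periodic up to a hop and a boost: `u(τ, y) = u(τ − P, y − d) + w` (`P > 0`).  Then `u = 0` a.e. on the slab: `H = 0` a.e.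
below `T₁` (`weakGradient_ae_zero_past`), so a.e. slice below `T₁` is a.e. constant and has zero energy by the `A`-gauge, and a member quiescent on a
past sub-slab is trivial (`PastSymmetric.ae_eq_zero_of_gauge_of_pastSlicesZero`). [folklore] -/
theorem ae_eq_zero_of_gauge_of_pastFramePeriodic {ρ : ℝ} (hρ : 0 < ρ) {p : ℝ → EuclideanSpace ℝ (Fin 3) → ℝ} {c : ℝ≥0}
    (hsw : IsSuitableWeakSolutionOn (slab (EuclideanSpace ℝ (Fin 3)) (Iio 0) isOpen_Iio) 0 0 u p)
    (hH : HasWeakSpatialGradientOn (slab (EuclideanSpace ℝ (Fin 3)) (Iio 0) isOpen_Iio) u H)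
    (hc : ∀ a : ℝ, 0 < a → ENNReal.ofReal (a ^ (2 * ρ)) * cknA a (0 : ℝ × EuclideanSpace ℝ (Fin 3)) u +
        ENNReal.ofReal (a ^ ρ) * cknE a (0 : ℝ × EuclideanSpace ℝ (Fin 3)) H +
        ENNReal.ofReal (a ^ (2 * ρ)) * cknD a (0 : ℝ × EuclideanSpace ℝ (Fin 3)) p ≤ (c : ℝ≥0∞))
    (hT₁ : T₁ ≤ 0) (hP : 0 < P) (hu : ∀ τ : ℝ, τ < T₁ → u τ = fun y => u (τ - P) (y - d) + w) :
    uncurry u =ᵐ[volume.restrict (Iio (0 : ℝ) ×ˢ (univ : Set (EuclideanSpace ℝ (Fin 3))))] 0 := by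
  have hE : ∀ a : ℝ, 0 < a → ENNReal.ofReal (a ^ ρ) * cknE a (0 : ℝ × EuclideanSpace ℝ (Fin 3)) H ≤ (c : ℝ≥0∞) :=
    fun a ha => le_trans (le_trans le_add_self le_self_add) (hc a ha)
  have hA : ∀ a : ℝ, 0 < a → ENNReal.ofReal (a ^ (2 * ρ)) * cknA a (0 : ℝ × EuclideanSpace ℝ (Fin 3)) u ≤ (c : ℝ≥0∞) :=
    fun a ha => le_trans (le_trans le_self_add le_self_add) (hc a ha)
  -- `H = 0` a.e. below `T₁`
  have hH0 := weakGradient_ae_zero_past hH hT₁ hP hu hρ hE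
  -- a.e. slice below `T₁` is a.e. constant, hence has zero energy
  have hslice := TypeIliouvilleNoTypeII.PowerGaugeSteady.ae_slice_const_of_weakGradient_ae_zero isOpen_Iio
    (hH.mono (slab_mono (Iio_subset_Iio hT₁))) hH0
  have hzero : ∀ᵐ τ ∂(volume.restrict (Iio T₁)), ∫⁻ x, ‖u τ x‖ₑ ^ 2 = 0 := by
    filter_upwards [hslice, ae_restrict_mem measurableSet_Iio] with τ hτ hτT
    obtain ⟨b, hb⟩ := hτ
    exact PastPeriodic.lintegral_slice_eq_zero_of_ae_const_of_gaugeA hρ hA (lt_of_lt_of_le hτT hT₁) hb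
  exact PastSymmetric.ae_eq_zero_of_gauge_of_pastSlicesZero hρ.le hsw hH hc hzero

/-- **THE FRAME-PERIODIC STRATUM, BY NAME** (`Sig.stub_framePeriodic` of line `galilean-frames` with the bodies of `InClass`, `IsPastFramePeriodic`,
`VanishesAE` verbatim; the binder `ρ ≤ 1/2` is idle — every `ρ > 0` works). [folklore] -/
theorem framePeriodic_stratum :
    ∀ ρ : ℝ, 0 < ρ → ρ ≤ 1 / 2 → ∀ (u : ℝ → EuclideanSpace ℝ (Fin 3) → EuclideanSpace ℝ (Fin 3)) (p : ℝ → EuclideanSpace ℝ (Fin 3) → ℝ)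
      (H : ℝ → EuclideanSpace ℝ (Fin 3) → EuclideanSpace ℝ (Fin 3) →L[ℝ] EuclideanSpace ℝ (Fin 3)) (c : ℝ≥0),
      (IsSuitableWeakSolutionOn (slab (EuclideanSpace ℝ (Fin 3)) (Set.Iio 0) isOpen_Iio) 0 0 u p ∧
        HasWeakSpatialGradientOn (slab (EuclideanSpace ℝ (Fin 3)) (Set.Iio 0) isOpen_Iio) u H ∧
        (∀ a : ℝ, 0 < a →
          ENNReal.ofReal (a ^ (2 * ρ)) * cknA a (0 : ℝ × EuclideanSpace ℝ (Fin 3)) u +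
              ENNReal.ofReal (a ^ ρ) * cknE a (0 : ℝ × EuclideanSpace ℝ (Fin 3)) H +
            ENNReal.ofReal (a ^ (2 * ρ)) * cknD a (0 : ℝ × EuclideanSpace ℝ (Fin 3)) p ≤ (c : ℝ≥0∞))) →
      (∃ (T₁ P : ℝ) (d w : EuclideanSpace ℝ (Fin 3)), T₁ ≤ 0 ∧ 0 < P ∧
        ∀ τ : ℝ, τ < T₁ → u τ = fun y => u (τ - P) (y - d) + w) →
      Function.uncurry u =ᵐ[volume.restrict (Set.Iio (0 : ℝ) ×ˢ (Set.univ : Set (EuclideanSpace ℝ (Fin 3))))] 0 := by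
  intro ρ hρ _ u p H c hcls hfp
  obtain ⟨hsw, hH, hc⟩ := hcls
  obtain ⟨T₁, P, d, w, hT₁, hP, hu⟩ := hfp
  exact ae_eq_zero_of_gauge_of_pastFramePeriodic hρ hsw hH hc hT₁ hP hu

end FramePeriodic

end Summit.NavierStokesRegularity.NavierStokesRegularity.Theorems.PowerGaugeEulerLiouville
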